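import Summits.HubbardSuperconductivity.HubbardSuperconductivity.Theorems.AnisotropyChordTransferFibre3C0Layer

/-!
# Route `AnisotropyChord` / H0 rotor rung: the pole shift `T⁺` bracketed by `⟨Π⁰,C0⟩` and `‖Π⁰‖²` (row-assembly input)

The row assemblies `…Fibre3KT1Assembly` / `…Fibre3KT2Assembly` (piece A, stmt-HubbardSuperconductivity-23918) take a bracket
`T⁻ ≤ T⁺ ≤ T⁺⁺` of the pole shift.  Both producers (p3's FIN kernel evaluator; theory-1's Level-2 row B, `δ₃ = ⟨Π⁰,C0⟩/(3λ₂‖Π⁰‖²)`)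
enclose instead the one-loop quantities `PC0 = Σ_c Π⁰(c)·C0(c)` and `‖Π⁰‖² = PiNormSq`; by the PROVED identity `sum_piR_C0fn`
(`⟨Π⁰,C0⟩ = (T⁺ − 3λ₂)‖Π⁰‖²`, …C0Layer) this file converts: ★ `Tplus_bracket` — for `0 < P⁻ ≤ ‖Π⁰‖² ≤ P⁺` and
`c⁻ ≤ ⟨Π⁰,C0⟩ ≤ c⁺`: `3λ₂ + min(c⁻/P⁻, c⁻/P⁺) ≤ T⁺ ≤ 3λ₂ + max(c⁺/P⁻, c⁺/P⁺)` (the four-corner rule of kt1_bound.py).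
Prover seat `hubbard-h0-rotor-p1` g26; helper for stmt-HubbardSuperconductivity-23918 (`--supports`, helper class).
WHAT THIS IS NOT: nothing here proves superconductivity in the Hubbard model; interval bookkeeping for ONE conditional reduction.
Tree imports only; no new definitions; no sorry, no axioms.
-/

set_option linter.dupNamespace false
set_option autoImplicit false

noncomputable section

open scoped BigOperators

namespace Summit.HubbardSuperconductivity.HubbardSuperconductivity.Theorems.AnisotropyChord.Transfer.Fibre3

namespace KT1Assembly

variable (L : ℕ) [NeZero L]

/-- the four-corner rule for a quotient: `x ∈ [lo, hi]`, `y ∈ [P⁻, P⁺] ⊂ (0, ∞)` ⇒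
`min(lo/P⁻, lo/P⁺) ≤ x/y ≤ max(hi/P⁻, hi/P⁺)`. [folklore] -/
theorem div_mem_corners {x y lo hi Plo Phi : ℝ} (hPlo : 0 < Plo) (hy1 : Plo ≤ y) (hy2 : y ≤ Phi)
    (hx1 : lo ≤ x) (hx2 : x ≤ hi) :
    min (lo / Plo) (lo / Phi) ≤ x / y ∧ x / y ≤ max (hi / Plo) (hi / Phi) := by
  have hy : 0 < y := lt_of_lt_of_le hPlo hy1
  have hPhi : 0 < Phi := lt_of_lt_of_le hy hy2
  constructor
  · have h1 : lo / y ≤ x / y := div_le_div_of_nonneg_right hx1 hy.le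
    rcases le_or_gt 0 lo with hlo | hlo
    · -- `lo ≥ 0`: `lo/P⁺ ≤ lo/y`
      have h2 : lo / Phi ≤ lo / y := div_le_div_of_nonneg_left hlo hy hy2
      exact (min_le_right _ _).trans (h2.trans h1)
    · -- `lo < 0`: `lo/P⁻ ≤ lo/y`
      have h2 : lo / Plo ≤ lo / y := by
        rw [div_le_div_iff₀ hPlo hy]; nlinarith
      exact (min_le_left _ _).trans (h2.trans h1)
  · have h1 : x / y ≤ hi / y := div_le_div_of_nonneg_right hx2 hy.le
    rcases le_or_gt 0 hi with hhi | hhi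
    · have h2 : hi / y ≤ hi / Plo := div_le_div_of_nonneg_left hhi hPlo hy1
      exact h1.trans (h2.trans (le_max_left _ _))
    · have h2 : hi / y ≤ hi / Phi := by
        rw [div_le_div_iff₀ hy hPhi]; nlinarith
      exact h1.trans (h2.trans (le_max_right _ _))

/-- ★ `T⁺` BRACKET from brackets on `⟨Π⁰,C0⟩ = Σ_c Π⁰·C0` and `‖Π⁰‖²` (two-magnon profile, `‖Π⁰‖² ≥ P⁻ > 0`):
`3λ₂ + min(c⁻/P⁻, c⁻/P⁺) ≤ T⁺ ≤ 3λ₂ + max(c⁺/P⁻, c⁺/P⁺)`. [folklore] -/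
theorem Tplus_bracket {Δ lam2 : ℝ} {f : Tor L → ℝ} (hf : IsTwoMagnon L Δ lam2 f)
    {clo chi Plo Phi : ℝ} (hPlo : 0 < Plo) (hP1 : Plo ≤ PiNormSq L f) (hP2 : PiNormSq L f ≤ Phi)
    (hc1 : clo ≤ ∑ c : Cfg L, piR L f c * C0fn L Δ lam2 f c) (hc2 : ∑ c : Cfg L, piR L f c * C0fn L Δ lam2 f c ≤ chi) :
    3 * lam2 + min (clo / Plo) (clo / Phi) ≤ Tplus L Δ f ∧
      Tplus L Δ f ≤ 3 * lam2 + max (chi / Plo) (chi / Phi) := by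
  have hid := sum_piR_C0fn L hf
  have hP : 0 < PiNormSq L f := lt_of_lt_of_le hPlo hP1
  have hq : Tplus L Δ f - 3 * lam2 = (∑ c : Cfg L, piR L f c * C0fn L Δ lam2 f c) / PiNormSq L f := by
    rw [hid, mul_div_assoc, div_self hP.ne', mul_one]
  obtain ⟨h1, h2⟩ := div_mem_corners hPlo hP1 hP2 hc1 hc2
  rw [← hq] at h1 h2
  constructor <;> linarith

end KT1Assembly

end Summit.HubbardSuperconductivity.HubbardSuperconductivity.Theorems.AnisotropyChord.Transfer.Fibre3

end
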